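import Summits.AnomalousDissipation.AnomalousDissipation.Theorems.GalerkinSteadyZerothLaw.Negative.LoadBearing
import Literature.Analysis.FluidPDE.TwoHalfNavierStokes

/-!
# Line `planar-carrier-dirichlet` — crux `MirrorVariety.GalerkinSteadyZerothLaw` (stmt-AnomalousDissipation-2986)
# Strategist's skeleton (planner-cstrat-stmt-AnomalousDissipation-2986-0, 2026-08-16).  TRANSFER lens: the solved sibling
# "anomalous dissipation of a passive scalar" (DEIJ 2022, Armstrong–Vicol 2025, Johansson–Sorella 2024 = arXiv:2409.03599,
# AUTONOMOUS planar field) run at crux level inside the `x₃`-invariant witness class of the crux.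

Crux (fixed, by name): SOME smooth divergence-free mean-zero steady force `f` on `T³`, SOME `ν_j → 0⁺`, `E`, `ε > 0` such that
for every `j` and INFINITELY MANY `N` there is a loud (`ν_j‖∇U‖² ≥ ε`) bounded (`∫|U|² ≤ E`) tested-form Galerkin steady state.

THE LINE.  Look for witnesses in the `x₃`-invariant class `U = (u, θ)(x₁,x₂)` with force `f = (g, s)(x₁,x₂)` (`Torus.twoHalf`):
the tested Galerkin equations on `T³` split into the PLANAR tested Galerkin Navier–Stokes equations for `u` with force `g`
(quiet at bounded energy by the landed planar Alexakis–Doering bound `Negative.planar_loudness_sq_le_of_energy_le`, which is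
harmless: the crux only asks for TOTAL loudness) and a LINEAR steady Galerkin advection–diffusion equation for the third component
`θ` with source `s`, advected by `u` at Prandtl number one (`SteadyScalar`).  Loudness of the lift is `ν‖∇u‖² + ν‖∇θ‖² ≥ ν‖∇θ‖²`,
and `ν‖∇θ‖²` has an exact VARIATIONAL floor — the nonreversible Dirichlet principle (Avellaneda–Majda 1991; Fannjiang–Papanicolaou
1994) in its elementary test-pair form, valid verbatim at the Galerkin level because the truncated advection `P_N(u·∇·)` is still
skew: for every band-limited `φ` and every planar field `F` with `div F = u·∇φ`,
  `ν‖∇θ‖² ≥ 2∫ s φ − ν‖∇φ‖² − ν⁻¹ ∫|F|²`            (`DirichletBound`, PROVABLE NOW, three lines of Young + IBP),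
with equality at the optimal pair.  So the crux follows (`line_glue` curried and `GalerkinSteadyZerothLaw_of` by name, both sorry-free outside the stubs) from
* `stub_dirichlet` (S–M, provable now): the test-pair floor above;
* `stub_lift25` (M, provable now over `TwoHalfNavierStokes` + `Theorems/TwoAndHalfDScalarLift2halfDRGalerkinTools`): the
  `x₃`-invariant lift of planar tested-Galerkin data is a tested-Galerkin steady state on `T³` of the lifted force, with
  `∫|U|² = ∫|u|² + ∫θ²`, `‖∇U‖² = ‖∇u‖² + ‖∇θ‖²`, and the lifted force is smooth, divergence free and mean zero;
* `stub_branchingCarriers` (HEART, crux-in-class): ONE planar force `g`, ONE source `s`, `ν_j → 0⁺` such that for every `j`,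
  frequently in `N`, there is a bounded planar tested-Galerkin steady state `u` (the CARRIER), whose steady Galerkin scalar `θ`
  is NON-RESONANT (`∫θ² ≤ E₂`) and which admits a Dirichlet test pair `(φ, F)` of size `ε` (the LOUDNESS CERTIFICATE: `φ`
  correlated with `s`, cheap in `ν‖∇φ‖²`, and almost a first integral of `u` in the flux sense `‖F‖² ≲ νε`, `div F = u·∇φ`).

WHY THIS IS NOT THE CRUX REWORDED.  The heart lives in a strict subclass (planar Navier–Stokes + a LINEAR problem), its loudness
clause is variational (a sup over explicit test pairs, constructible from stream-function geometry: `φ = Φ(ψ_u)` mollified at the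
Batchelor scale, `F` = the defect flux), and its two demands are the known physics of steady scalar anomaly: BRANCHING carriers
(non-weak-Sard-like stagnation structure refining with `ν`; weak-Sard autonomous limits renormalise and are quiet —
Alberti–Bianchini–Crippa JEMS 2014 Thm 4.7, Bagnara et al. arXiv:2603.11466 Thm 1.2; non-weak-Sard autonomous fields DO dissipate —
Johansson–Sorella arXiv:2409.03599 Thm 1.1) and NON-RESONANCE (zero streamline means of `s` at scale `ν`).
HONEST RATING (strategist): low plausibility — it stacks (a) bounded-energy zero-momentum steady planar states as `ν → 0`
(sibling crux stmt-AnomalousDissipation-10786, open, own chain), (b) non-Prandtl–Batchelor (branching) limits of fixed-force steady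
planar states (contrary to PB selection, Fei–Gao–Lin–Tao arXiv:2111.03996), (c) non-resonance.  Registered as OPTION VALUE for the
continuation lead (switch only if the coat line dies AND 10786 lands a bounded planar branch), for its two provable reusable stubs,
and as the typed target of the standing disprover's announced 2½-D attack (Disproof.lean §6.5(i)).

DISPROOF OBLIGATIONS (Cruxes/GalerkinSteadyZerothLaw/Disproof.lean, cycles 1–2, NO KILL): §3 bounded ∧ loud ∧ `ν → 0` all sit in the
heart; §4 (dimension load-bearing, `not_galerkinSteadyZerothLaw2D`): the class is three-component — the enstrophy production of the
lift is `−∫∇θ·S_u·∇θ` (scalar-gradient stretching by the planar strain), nonzero, exactly the term the planar identity kills for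
two components; §2b scale covariance respected (statement is scale-free in `(E₁,E₂,ε)`); §6.5(i): the single-shell-`g` sub-case is
closed negatively (CTV pincer ⇒ `H²`-bounded carriers ⇒ DiPerna–Lions) — the heart's `g` must charge ≥ 2 shell radii (recorded in
the line card as a design constraint, not typed).  No landed Negative lemma has an instance among the stubs (checked against
`Negative/LoadBearing`, `Negative/StokesStates`, `Negative/Planar`).

House rules: `sorry` only inside `stub_*`; the composition and the closing check are sorry-free.
-/

noncomputable section

-- D-0017: single-problem summit ⇒ the duplicated namespace segment is by design.
set_option linter.dupNamespace false

open scoped InnerProductSpace Topology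
open MeasureTheory Filter UnitAddTorus
open Literature.Analysis.FunctionSpaces Literature.Analysis.FunctionSpaces.Torus
open Literature.Analysis.FluidPDE Literature.Analysis.FluidPDE.Torus

namespace Summit.AnomalousDissipation.AnomalousDissipation.Cruxes.GalerkinSteadyZerothLaw.PlanarCarrierDirichlet

open Summit.AnomalousDissipation.AnomalousDissipation.Theses.MirrorVariety (GalerkinSteadyZerothLaw)
open Summit.AnomalousDissipation.AnomalousDissipation.Theorems.GalerkinSteadyZerothLaw.Negative
  (SteadyState BandLimited FrequentlyLoud LoudWitness crux_iff)

/-- The flat two-torus (local notation). -/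
local notation "𝕋²" => UnitAddTorus (Fin 2)
/-- Planar velocity values (local notation). -/
local notation "E²" => EuclideanSpace ℝ (Fin 2)

/-! ## §0 Vocabulary of the line (transparent) -/

/-- Band-limitation of a real planar scalar to the punctured frequency ball `0 < |k|² ≤ N²` (the scalar analogue of the crux's
clause; `θ` is viewed in `ℂ` for `mFourierCoeff`). -/
def ScalarBandLimited (N : ℕ) (θ : 𝕋² → ℝ) : Prop :=
  ∀ k ∉ (freqBall N).erase (0 : Fin 2 → ℤ), mFourierCoeff (fun x => (θ x : ℂ)) k = 0

/-- **Steady Galerkin sourced scalar in tested form** at `(ν, N)`, advected by the planar field `u`, with source `s`: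
`θ` smooth, band-limited, and `∫ (θ·(u·∇ψ) + ν θ Δψ + s ψ) = 0` for every smooth band-limited test `ψ` — the tested form of
`u·∇θ = νΔθ + s` at level `N` (the third component of the crux's bracket for an `x₃`-invariant state, cf. `stub_lift25`).
For divergence-free `u` and `ν > 0` it has exactly one solution (the symmetric part of the truncated operator is `−νΔ`). -/
def SteadyScalar (ν : ℝ) (N : ℕ) (u : 𝕋² → E²) (s θ : 𝕋² → ℝ) : Prop :=
  IsSmooth θ ∧ ScalarBandLimited N θ ∧
    ∀ ψ : 𝕋² → ℝ, IsSmooth ψ → ScalarBandLimited N ψ →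
      ∫ x, (θ x * convect u ψ x + ν * (θ x * laplacian ψ x) + s x * ψ x) = 0

/-- **Dirichlet test pair (loudness certificate) of size `ε`** for the carrier `u` and the source `s` at `(ν, N)`: a smooth
band-limited scalar `φ` and a smooth planar FLUX `F` with `div F = u·∇φ` pointwise, such that
`ε ≤ 2∫ s φ − ν‖∇φ‖² − ν⁻¹∫|F|²`.  By `DirichletBound` any such pair certifies `ν‖∇θ‖² ≥ ε` for the steady scalar; the
supremum over pairs is the nonreversible Dirichlet principle (equality at the optimal pair). -/
def LoudnessCertificate (ν ε : ℝ) (N : ℕ) (u : 𝕋² → E²) (s : 𝕋² → ℝ) : Prop :=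
  ∃ (φ : 𝕋² → ℝ) (F : 𝕋² → E²), IsSmooth φ ∧ ScalarBandLimited N φ ∧ IsSmooth F ∧
    (∀ x, divergence F x = convect u φ x) ∧
    ε ≤ 2 * (∫ x, s x * φ x) - ν * scalarGradNormSq φ - ν⁻¹ * ∫ x, ‖F x‖ ^ 2

/-! ## §1 The three registered stubs, as named propositions -/

/-- **Stub 1 statement — the nonreversible Dirichlet floor (Galerkin level).**  For `ν > 0`, a smooth divergence-free carrier
`u`, a continuous source `s`, the tested steady Galerkin scalar `θ` and ANY certificate pair `(φ, F)` of size `ε`: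
`ε ≤ ν‖∇θ‖²`.  Proof (paper, three lines): test `SteadyScalar` with `ψ := φ` and integrate by parts twice,
`∫ s φ = ∫⟪∇θ, F + ν∇φ⟫ ≤ ‖∇θ‖ ‖F + ν∇φ‖`; the cross term `∫⟪F, ∇φ⟫ = −∫ φ div F = −∫ φ (u·∇φ) = 0` (`div u = 0`), so
`‖F + ν∇φ‖² = ‖F‖² + ν²‖∇φ‖²`; Young `2ab ≤ νa² + b²/ν`.  [cite: AvellanedaMajda1991; FannjiangPapanicolaou1994] -/
def DirichletBound : Prop :=
  ∀ (ν ε : ℝ) (N : ℕ) (u : 𝕋² → E²) (s θ : 𝕋² → ℝ),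
    0 < ν → IsSmooth u → IsDivFree u → Continuous s →
    SteadyScalar ν N u s θ → LoudnessCertificate ν ε N u s → ε ≤ ν * scalarGradNormSq θ

/-- **Stub 2 statement — the `x₃`-invariant Galerkin lift.**  Planar tested-Galerkin steady state `u` of the planar force `g` at
`(ν, N)` (`Negative.SteadyState` at `d = Fin 2`) plus the tested steady Galerkin scalar `θ` with source `s` give: the lifted force
`twoHalf g s` is smooth, divergence free and mean zero, the lift `twoHalf u θ` is a tested-Galerkin steady state of it on `T³`
(verbatim the crux's bracket, `Negative.SteadyState` at `d = Fin 3`), and energy / squared gradient split additively.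
Proof (paper): Fourier support of a lift is `{(k₁,k₂,0)}` (`Theorems…GalerkinTools.mFourierCoeff_twoHalf_eq_zero`); for a
three-dimensional band-limited test `a`, integrate in `x₃` first (`TorusAxisAverage`): the `x₃`-average `ā = (ā_h, ā₃)` is
band-limited, `ā_h` planar divergence free, and `∫⟪U,(U·∇)a⟫ + ν⟪U,Δa⟫ + ⟪f,a⟫` equals the planar bracket of `u` against `ā_h`
plus the scalar bracket of `θ` against `ā₃` (`convect_twoHalf`, `laplacian_twoHalf`, `inner_twoHalf`; the term `θ ∂₃a` integrates
to zero); energy and gradient: `integral_norm_sq_twoHalf`, `gradNormSq_twoHalf`; mean: `hasZeroMean_twoHalf`.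
[cite: MajdaBertozzi2002, §2.3.1; Cheskidov2023, §3 (3.13)] -/
def Lift25 : Prop :=
  ∀ (ν : ℝ) (N : ℕ) (g u : 𝕋² → E²) (s θ : 𝕋² → ℝ),
    IsSmooth g → IsDivFree g → HasZeroMean g → IsSmooth s → HasZeroMean s →
    SteadyState ν N g u → SteadyScalar ν N u s θ →
    IsSmooth (twoHalf g s) ∧ IsDivFree (twoHalf g s) ∧ HasZeroMean (twoHalf g s) ∧
      SteadyState ν N (twoHalf g s) (twoHalf u θ) ∧
      ∫ x, ‖twoHalf u θ x‖ ^ 2 = (∫ y, ‖u y‖ ^ 2) + ∫ y, θ y ^ 2 ∧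
      gradNormSq (twoHalf u θ) = gradNormSq u + scalarGradNormSq θ

/-- **Stub 3 statement — THE HEART: branching, non-resonant planar carriers for one designed `(g, s)`.**  One smooth
divergence-free mean-zero planar force `g`, one smooth mean-zero source `s`, positive `ν_j → 0`, budgets `E₁, E₂` and `ε > 0`
such that for every `j`, FREQUENTLY in `N`: a planar tested-Galerkin steady state `u` of `g` at `(ν_j, N)` with `∫|u|² ≤ E₁`
(CARRIER; its own dissipation is `O(ν^{1/2})`, irrelevant), its steady Galerkin scalar `θ` with `∫θ² ≤ E₂` (NON-RESONANCE), and a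
Dirichlet test pair of size `ε` (BRANCHING made quantitative).  Why it might fail: (a) bounded-energy zero-momentum steady planar
states under a fixed force as `ν → 0` are themselves open (crux stmt-AnomalousDissipation-10786; first-shell `g` is rigid —
`Theorems/TwodBoundedEnergyZeroMomentum/Negative`); (b) Prandtl–Batchelor selection predicts weak-Sard (cells + `ν^{1/2}` layers)
limits, for which every pair has `2∫sφ − ν⁻¹‖F‖² → 0` or `∫θ² → ∞`; (c) single-shell `g` is closed negatively (Disproof §6.5(i)).
Sources: JohanssonSorella2024 (arXiv:2409.03599, Thm 1.1, Rem. 1.3–1.4), AlbertiBianchiniCrippa2014 (doi:10.4171/jems/431),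
arXiv:2603.11466 Thm 1.2, FeiGaoLinTao (arXiv:2111.03996), summit cards `frozen-non-sard-steady-witness`,
`nonreversible-dirichlet-principle-scalar-dissipation`. -/
def BranchingCarriers : Prop :=
  ∃ (g : 𝕋² → E²) (s : 𝕋² → ℝ), IsSmooth g ∧ IsDivFree g ∧ HasZeroMean g ∧ IsSmooth s ∧ HasZeroMean s ∧
    ∃ (ν : ℕ → ℝ) (E₁ E₂ ε : ℝ), (∀ j, 0 < ν j) ∧ Tendsto ν atTop (𝓝 0) ∧ 0 < ε ∧
      ∀ j, ∃ᶠ N in atTop, ∃ (u : 𝕋² → E²) (θ : 𝕋² → ℝ),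
        SteadyState (ν j) N g u ∧ ∫ x, ‖u x‖ ^ 2 ≤ E₁ ∧
        SteadyScalar (ν j) N u s θ ∧ ∫ x, θ x ^ 2 ≤ E₂ ∧
        LoudnessCertificate (ν j) ε N u s

/-! ## §2 Registered stubs -/

/-- Stub 1 (S–M, provable now): the nonreversible Dirichlet floor, see `DirichletBound`. -/
theorem stub_dirichlet : DirichletBound := by
  sorry

/-- Stub 2 (M, provable now): the `x₃`-invariant Galerkin lift, see `Lift25`. -/
theorem stub_lift25 : Lift25 := by
  sorry

/-- Stub 3 (HEART, crux-in-class, XL): branching non-resonant carriers, see `BranchingCarriers`. -/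
theorem stub_branchingCarriers : BranchingCarriers := by
  sorry

/-! ## §3 Composition (sorry-free): the three stubs give the crux BY NAME -/

/-- **The line's glue (curried, sorry-free): the three stub STATEMENTS give a loud witness force.**  Force `f := twoHalf g s`;
budgets `E := E₁ + E₂`, same `ν`, same `ε`; at each of the frequently many `N` the witness is the lift `twoHalf u θ`: admissible
and steady by `Lift25`, energy `∫|u|² + ∫θ² ≤ E₁ + E₂`, loudness `ν(‖∇u‖² + ‖∇θ‖²) ≥ ν‖∇θ‖² ≥ ε` by `DirichletBound` applied to
the certificate.  The conclusion is the right-hand side of the landed `Negative.crux_iff` (an `Iff.rfl`). -/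
theorem line_glue (hD : DirichletBound) (hL : Lift25) (hH : BranchingCarriers) :
    ∃ f : UnitAddTorus (Fin 3) → EuclideanSpace ℝ (Fin 3), IsSmooth f ∧ IsDivFree f ∧ HasZeroMean f ∧ LoudWitness f := by
  obtain ⟨g, s, hg, hgd, hgm, hs, hsm, ν, E₁, E₂, ε, hν, hlim, hε, H⟩ := hH
  -- admissibility of the lifted force, read off from any one witness (it does not depend on the witness)
  obtain ⟨N₀, u₀, θ₀, hu₀, -, hθ₀, -, -⟩ := (H 0).exists
  obtain ⟨hfs, hfd, hfm, -, -, -⟩ := hL (ν 0) N₀ g u₀ s θ₀ hg hgd hgm hs hsm hu₀ hθ₀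
  refine ⟨twoHalf g s, hfs, hfd, hfm, ν, E₁ + E₂, ε, hν, hlim, hε, fun j => ?_⟩
  refine (H j).mono fun N hN => ?_
  obtain ⟨u, θ, hu, hEu, hθ, hEθ, hcert⟩ := hN
  obtain ⟨-, -, -, hS, hE, hG⟩ := hL (ν j) N g u s θ hg hgd hgm hs hsm hu hθ
  refine ⟨twoHalf u θ, hS, ?_, ?_⟩
  · rw [hE]
    linarith
  · have hd : ε ≤ ν j * scalarGradNormSq θ :=
      hD (ν j) ε N u s θ (hν j) hu.1 hu.2.1 hs.continuous hθ hcert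
    have h0 : 0 ≤ ν j * gradNormSq u := mul_nonneg (hν j).le (gradNormSq_nonneg u)
    rw [hG, mul_add]
    linarith

/-- **The line closes the crux BY NAME** from the three registered stubs (sorries only upstream, inside the stubs). -/
theorem GalerkinSteadyZerothLaw_of :
    Summit.AnomalousDissipation.AnomalousDissipation.Theses.MirrorVariety.GalerkinSteadyZerothLaw :=
  crux_iff.2 (line_glue stub_dirichlet stub_lift25 stub_branchingCarriers)

end Summit.AnomalousDissipation.AnomalousDissipation.Cruxes.GalerkinSteadyZerothLaw.PlanarCarrierDirichlet

end
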